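/- Copyright: the b2b-balaban cell (near-miss cell 7), T⁴-continuum fan-out; row NE7b CRUX team (2), seat
t4-ne7b-formalise-leaf-05 (gen 35) — IR-46-2's standing division «… leaf-05 toy-instantiates» applied to the OWNER's INTERFACE
REQUEST NE7b IR-52-1 «THE LATTICE-UNIT ROAD» item (d) (RULINGS R-OWNER-52-3 ∕ R-OWNER-53-1, `CLAIMS.log` l.35615 ∕ l.35706;
record (a) `HistoryRealiseCellsRunAssemblyWTVSDataLWL` by the custodian leaf-03 g29, R-OWNER-53-2), part 15 of the sanity series (PRE-READ
P-ne7bleaf05-g35-1 l.35666, WORD W-ne7bleaf05-g35-1 l.35748).  Released under the licence of the surrounding project. -/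
import Summits.QuantumFields.BalabanUV.T4Continuum.Support.HistoryRealiseCellsRunAssemblyWTVSSanityLWEnd
import Summits.QuantumFields.BalabanUV.T4Continuum.Support.HistoryRealiseCellsRunAssemblyWTVSDataLWL
import Summits.QuantumFields.BalabanUV.T4Continuum.Support.HistoryBankingVolumeWindowLattice

/-!
# Sanity for the (α) assembly, part 15: THE LATTICE-UNIT TWIN `HistReadDataLWL` ON THE TOY READING — THE LATTICE PIN
`lamVolL`, ONE SET OF LETTERS AT ANY COST LETTER (`Φ₅`), TOY CONSTANTS `C₄`, AND THE RECORD FOR ANY DATUM FROM THE DISPLAYED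
INPUTS (companion of `HistoryRealiseCellsRunAssemblyWTVSDataLWL`; lineage `t4-ne7b-formalise-leaf-05` gen 35)

Summits-side support leaf of the T⁴-continuum cell (rung (B)+1 on a FINITE torus only; NOT infinite volume, NOT the
mass gap, NOT Clay; NOT a proof of NE7b — NOT PRINTED, NOT PROVED).  [folklore]∕[decided toy] over parts 5–7 (`ℛ₄`, `Φ₄`,
`histReadDataLW₄`, `gW`), leaf-06's `HistoryBankingVolumeWindowLattice` (`uvolL`, `uvolL_nonneg`, `uvolL_eq_mul_uvol`) and
the custodian's lattice-unit record (a) (free lattice letter `M`, R-OWNER-53-2), REUSED BY NAME; three `def`s (`lamVolL`, `Φ₅`, `C₄`) + one record constructor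
(`histReadDataLWL₄`); nothing printed asserted, no `def … : Prop` fact, no cite-tagged hypothesis, zero `sorry`.  The toy
instance (`M := 1`) and the custodian's (b) `toLP82L` run on it are part 16 (`…SanityLWLEnd`).

WHY (R-OWNER-53-1 (3) ∕ R-OWNER-53-2, adopting P-ne7bleaf05-g35-1): the lattice-unit record carries a FREE lattice letter `M`
(`hMΛ : 0 ≤ M`), REPLACES LW's per-cube display `hΛ` by `hΛL : log (Φf.Λ K t) = uvolL cΛ M d g (ℛ.R K) K t` and the
per-cube bookkeeping rows `hexpF`∕`hexpV` by `hexpFL : 1 + κ₂ = rr·(q′ − d)`, `hdq : d ≤ q′`, `hexpVL : 1 + rr·d + κᵥ = 2p₀`;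
the toy must therefore (i) pin the cost letter at
`exp (uvolL …)` instead of `lamVol`, (ii) run at toy constants meeting the LATTICE identities — `C₃` (`q′ = 2`) is refused
by `hexpFL` at `d = rr = 1` (`κ₂ = 0`), `C₄` (`q′ = 3`, `p₀ = 3`) with `(p₁, η, η′, κ, κ₂, κᵥ) = (5, 3, 2, 2, 1, 4)` passes.

§19 **`lamVolL cΛ M d g R K t := exp (uvolL cΛ M d g R K t)`** — `log_lamVolL`, `one_le_lamVolL`, **`lamVolL_eq_rpow`**
(the lattice pin IS the per-cube pin raised to the site count `(M·R_{t∧K})^d`: G-M5-2's two currencies as one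
exponentiation); **`Φ₅ (Λ) (hΛ1)`** — part 5's `Φ₄` with the cost letter a PARAMETER (`Φ₅_lamVol : … = Φ₄ …` by `rfl`),
`factorRead_toy₅`, `Λ_toy₅`, `histRead_toy₅`, `BA_le_of_le₅`.
§20 **`C₄ := ⟨13, 0, 3, 1, 1, 0, 0, 0, 0, 0, 1, 3⟩`**, `identities_C₄` (decided).
§21 **`histReadDataLWL₄ (D) … (hMΛ : 0 ≤ M) … : HistReadDataLWL D C O θv rr 1 n hn g₀ os cΛ M …`** — part 6's
`histReadDataLW₄` FIELD FOR FIELD with `Φf := Φ₅ … (fun K t => lamVolL cΛ M 1 (g K) ((ℛ₄ F.L Rc).R K) K t)`,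
`hΛL := log_lamVolL …`, `hMΛ`, the exponent rows `hexpFL hdq hexpVL` as PARAMETERS (the S-rows), `hΛ1` at the lattice pin;
every other field as part 6 (any `M ≥ 0`; the toy of part 16 takes `M := 1 = O₁.M`).

HONEST.  [decided toy] bookkeeping over OUR carriers at TOY letters (c2); the lattice pin is A LETTER WE CHOOSE for the toy,
nothing about Bałaban's volume factor (H3∕M2-B, [B16] p. 380: `hΛL` stays R on a real reading); every R∕S field of
`HistReadDataLWL` stays a HYPOTHESIS of the assembly for real data; (B) FAILS on the toy datum; BY-NAME EFFECT ON THE WALL: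
NONE; NE7b NOT PRINTED ∕ NOT PROVED; spine 0∕9.  HONEST DEPENDENCY (cell): continuum YM on T⁴ ⇐ BetaPertH ∧ nine spine
estimates (0/9 proved); BetaPertH ⇐ (D1) ∧ (D4) ∧ CAP+tail; G-an2-4 gates asym, D1 and NE2/3/4.  Unchanged here.
-/

open Finset MeasureTheory
open Literature.MathematicalPhysics.QuantumFieldTheory.Balaban1983to89
open Literature.MathematicalPhysics.QuantumFieldTheory.Balaban1983to89.B16SProfile (DropCtl)
open T4PersistenceDictionary T4PersistentHistoryCount T4BankedInduction T4PrintedShapeBanking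
open T4WeightBudget T4GlobalDenominator T4LiveClassFibration T4LiveStructureGas T4LiveGasToTerms T4RecordPriceSeam
open T4PartnerMultiplicity T4IndicatorShell T4MatchingAssembly T4MatchingClosure T4MatchingClosureSocket T4Continuum
open T4StabilitySocket T4BranchingRecordsGas T4TaggedShapeBanking T4CanonicalMenus T4RenewalChains
open Summit.QuantumFields.BalabanUV.T4Continuum.HistoryFlow Summit.QuantumFields.BalabanUV.T4Continuum.HistoryGen
open Summit.QuantumFields.BalabanUV.T4Continuum.HistoryAdmissible
open Summit.QuantumFields.BalabanUV.T4Continuum.HistoryGenealogyExtraction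
open Summit.QuantumFields.BalabanUV.T4Continuum.HistoryGenealogyRealise
open Summit.QuantumFields.BalabanUV.T4Continuum.HistoryGenealogyInstantiate
open Summit.QuantumFields.BalabanUV.T4Continuum.HistoryGenealogyPedigree
open Summit.QuantumFields.BalabanUV.T4Continuum.HistoryAssemblyPedigree Summit.QuantumFields.BalabanUV.T4Continuum.HistoryAssemblyTerms
open Summit.QuantumFields.BalabanUV.T4Continuum.HistoryAssemblyMult Summit.QuantumFields.BalabanUV.T4Continuum.HistoryAssemblyMultKey
open Summit.QuantumFields.BalabanUV.T4Continuum.HistoryAssemblyRealiseRun Summit.QuantumFields.BalabanUV.T4Continuum.HistorySocketTH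
open Summit.QuantumFields.BalabanUV.T4Continuum.HistoryRealiseDistinct
open Summit.QuantumFields.BalabanUV.T4Continuum.HistoryRealiseCellsRunApexT3bWTVS
open Summit.QuantumFields.BalabanUV.T4Continuum.B16HistoryIndexedRepr
open Summit.QuantumFields.BalabanUV.T4Continuum.B16HistoryIndexedTrunc
open Summit.QuantumFields.BalabanUV.T4Continuum.HistoryBankingLE Summit.QuantumFields.BalabanUV.T4Continuum.HistoryBankingVolumePlug
open Summit.QuantumFields.BalabanUV.T4Continuum.HistoryConstants Summit.QuantumFields.BalabanUV.T4Continuum.HistoryBankingDiscountCharge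
open Summit.QuantumFields.BalabanUV.T4Continuum.HistoryBankingCreditRead Summit.QuantumFields.BalabanUV.T4Continuum.HistoryBankingFibreRoom
open Summit.QuantumFields.BalabanUV.T4Continuum.HistoryPriceNodeSum Summit.QuantumFields.BalabanUV.T4Continuum.HistoryPriceKeys
open Summit.QuantumFields.BalabanUV.T4Continuum.HistoryRealiseCellsRunSupplyWTVS
open Summit.QuantumFields.BalabanUV.T4Continuum.HistoryRealiseCellsRunSupplyKeysWTVS
open Summit.QuantumFields.BalabanUV.T4Continuum.HistoryRealiseCellsRunSupplyWTVSSanity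
open Summit.QuantumFields.BalabanUV.T4Continuum.HistoryRealiseCellsRunSupplyKeysWTVSSanity
open Summit.QuantumFields.BalabanUV.T4Continuum.HistoryRealiseCellsRunAssemblyWTVSData
open Summit.QuantumFields.BalabanUV.T4Continuum.HistoryRealiseCellsRunAssemblyWTVS
open Summit.QuantumFields.BalabanUV.T4Continuum.HistoryRealiseCellsRunAssemblyWTVSDataL
open Summit.QuantumFields.BalabanUV.T4Continuum.HistoryRealiseCellsRunAssemblyWTVSDataLW
open Summit.QuantumFields.BalabanUV.T4Continuum.HistoryRealiseCellsRunAssemblyWTVSDataLWL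
open Summit.QuantumFields.BalabanUV.T4Continuum.HistoryBankingSharpShares (ell sBsharp)
open Summit.QuantumFields.BalabanUV.T4Continuum.HistoryBankingRoundingUnrounded (sRunr ApFlat)
open Summit.QuantumFields.BalabanUV.T4Continuum.HistoryBankingVolumeWindow (uvol lamVol log_lamVol one_le_lamVol)
open Summit.QuantumFields.BalabanUV.T4Continuum.HistoryBankingVolumeWindowLattice (uvolL uvolL_nonneg uvolL_eq_mul_uvol)

namespace Summit.QuantumFields.BalabanUV.T4Continuum.HistoryRealiseCellsRunAssemblyWTVSSanity

noncomputable section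

open B16HistoryIndexedRepr.Sanity B16HistoryIndexedRepr.SanityInput HistoryConstants.Sanity HistoryBankingCreditRead.Sanity

-- the structural `DecidableEq` instance of the concrete tag type exceeds the default synthesis size (as in the siblings)
set_option synthInstance.maxSize 1024

/-! ## §19 The lattice pin and one set of toy letters at ANY cost letter -/

section LatticePin

/-- **THE LEVEL COST PINNED AT THE LATTICE LETTER**: `lamVolL cΛ M d g R K t = exp (cΛ·(M·R_{t∧K})^d·ℓ_{t∧K})` (leaf-06's
`uvolL` exponentiated; the lattice twin of `HistoryBankingVolumeWindow.lamVol`). [folklore] -/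
def lamVolL (cΛ M : ℝ) (d : ℕ) (g : ℕ → ℝ) (R : ℕ → ℕ) (K t : ℕ) : ℝ := Real.exp (uvolL cΛ M d g R K t)

/-- the pinned cost's logarithm IS the lattice letter. [folklore] -/
@[simp] theorem log_lamVolL (cΛ M : ℝ) (d : ℕ) (g : ℕ → ℝ) (R : ℕ → ℕ) (K t : ℕ) :
    Real.log (lamVolL cΛ M d g R K t) = uvolL cΛ M d g R K t :=
  Real.log_exp _

/-- the pinned cost is at least one (`cΛ, M ≥ 0`, `ℓ_j ≥ 1` on the performed range). [folklore] -/
theorem one_le_lamVolL {cΛ M : ℝ} {d : ℕ} {g : ℕ → ℝ} {R : ℕ → ℕ} {K : ℕ} (hc : 0 ≤ cΛ) (hM : 0 ≤ M)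
    (hℓ : ∀ j, j ≤ K → 1 ≤ ell g j) (t : ℕ) : 1 ≤ lamVolL cΛ M d g R K t :=
  Real.one_le_exp_iff.2 (uvolL_nonneg hc hM hℓ t)

/-- the lattice pin IS the per-cube pin raised to the site count: `lamVolL = lamVol ^ ((M·R_{t∧K})^d)` (real power). [folklore] -/
theorem lamVolL_eq_rpow (cΛ M : ℝ) (d : ℕ) (g : ℕ → ℝ) (R : ℕ → ℕ) (K t : ℕ) :
    lamVolL cΛ M d g R K t = lamVol cΛ g K t ^ ((M * R (min t K)) ^ d) := by
  rw [lamVolL, uvolL_eq_mul_uvol, lamVol, ← Real.exp_mul, mul_comm]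

end LatticePin

section Letters

variable (O : PrintedO1s) (m : ℝ) (C : T4PrintedShapeBanking.Consts) (Lr : ℝ) (p₁ Rc : ℕ)
  (g : ℕ → ℕ → ℝ) (Z : ℕ → ℝ → ℝ) (Λ : ℕ → ℕ → ℝ)

/-- **TOY FACTOR DATA AT ANY LEVEL COST `Λ`** (`1 ≤ Λ` displayed as `hΛ1`): part 5's `Φ₄` with the per-cube pin replaced
by a cost letter PARAMETER — at `Λ := lamVol cΛ (g K) K t` it is `Φ₄` (`Φ₅_lamVol`), at `Λ := lamVolL cΛ M d (g K) R K t` the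
letters of the lattice-unit road (IR-52-1). [folklore] -/
def Φ₅ (hΛ1 : ∀ K t, 1 ≤ Λ K t) : HistFactors Isk 1 where
  fB K j d _ := Real.exp (-sBsharp O m C (g K) j d)
  fR K h := Real.exp (-sRunr O.γ₀ O.A₁ O.M Lr O.β₀ O.d p₁ (fun _ => Rc) (g K) h)
  Λ := Λ
  one_le_Λ := hΛ1
  wZ _ _ _ _ := 1
  wY _ _ _ _ := 1
  wC _ _ _ _ := 1
  BA K t := Real.log (Z K t / 6)
  BV _ _ _ _ _ _ := 0

variable (hΛ1 : ∀ K t, 1 ≤ Λ K t)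

/-- at the per-cube pin the generic letters ARE part 5's `Φ₄` (`rfl`). [folklore] -/
theorem Φ₅_lamVol (cΛ : ℝ) (hΛ1 : ∀ K t, 1 ≤ lamVol cΛ (g K) K t) :
    Φ₅ O m C Lr p₁ Rc g Z (fun K t => lamVol cΛ (g K) K t) hΛ1 = Φ₄ O m C Lr p₁ Rc cΛ g Z hΛ1 := rfl

/-- the factor reading holds at the fixed letter `S_h` (and at the floor `sBsharp`) — with equality. [folklore] -/
theorem factorRead_toy₅ (L K : ℕ) :
    FactorRead ((Φ₅ O m C Lr p₁ Rc g Z Λ hΛ1).fB K) ((Φ₅ O m C Lr p₁ Rc g Z Λ hΛ1).fR K) (sBsharp O m C (g K))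
      (sRunr O.γ₀ O.A₁ O.M Lr O.β₀ O.d p₁ ((ℛ₄ L Rc).R K) (g K)) :=
  factorRead_exp _ _

/-- the cost letter reads back (`rfl`); at the lattice pin its logarithm is `uvolL` (`log_lamVolL`). [folklore] -/
theorem Λ_toy₅ (K t : ℕ) : (Φ₅ O m C Lr p₁ Rc g Z Λ hΛ1).Λ K t = Λ K t := rfl

/-- `HistRead` holds for `Φ₅` and the toy expansions on the toy reading (empty forest; envelopes attained; source radius `1`,
threshold `0`) — the cost letter never enters. [folklore] -/
theorem histRead_toy₅ (L : ℕ) : HistRead (ℛ₄ L Rc) (Φ₅ O m C Lr p₁ Rc g Z Λ hΛ1) (fun K t => toyR (Z K t)) 1 0 where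
  χ01 _ _ _ _ := ⟨zero_le_one, le_rfl⟩
  tz_le _ _ _ _ _ _ _ _ := le_of_eq rfl
  ty_le _ _ _ _ _ _ _ _ := le_of_eq rfl
  tc_le _ _ _ _ _ _ _ _ := le_of_eq rfl
  A'_le _ _ _ _ _ := le_rfl
  Vs_le _ _ _ _ _ _ _ _ _ := le_rfl
  forest_le K t _ _ a ι _ := by
    show (1 : ℝ) * 1 ≤ _
    rw [Finset.prod_congr rfl fun j _ => by rw [compM_runOf_eq_empty₄ L Rc K a ι j, Finset.prod_empty],
      Finset.prod_const_one]
    norm_num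

variable {Z} in
/-- the completed-action envelope is bounded along `|t| ≤ 1` by `log (Zi∕6)`. [folklore] -/
theorem BA_le_of_le₅ {Zi : ℝ} (hpos : ∀ K t, |t| ≤ 1 → 0 < Z K t) (hle : ∀ K t, |t| ≤ 1 → Z K t ≤ Zi) (K : ℕ) {t : ℝ}
    (ht : |t| ≤ 1) : (Φ₅ O m C Lr p₁ Rc g Z Λ hΛ1).BA K t ≤ Real.log (Zi / 6) :=
  Real.log_le_log (by have := hpos K t ht; positivity) (by have := hle K t ht; linarith)

end Letters

/-! ## §20 Toy constants the lattice twin accepts (P-ne7bleaf05-g35-1 (P3)) -/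

/-- **TOY MODEL CONSTANTS FOR THE LATTICE-UNIT TWIN** `(n₁, dC, q′, E₂, E₃, κ₁, E₀, Eb, μ, a, A₀, p₀) =
(13, 0, 3, 1, 1, 0, 0, 0, 0, 0, 1, 3)` — TOY symbols (c2) meeting `13 ≤ n₁`, `0 < E₂`, `0 < E₃`, `1 ≤ p₀`, `0 < A₀` and, at
`rr = 1`, `d = 1`, the census identities of the LATTICE road (`identities_C₄`); part 5's `C₃` (`q′ = 2`) is refused by the
lattice floor row `1 + κ₂ = rr·(q′ − d)`. [folklore] -/
def C₄ : T4PrintedShapeBanking.Consts := ⟨13, 0, 3, 1, 1, 0, 0, 0, 0, 0, 1, 3⟩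

/-- the census identities at `C₄`, `O₁` (`O₁.d = 1`), record dimension `d = 1`, `rr = 1`, `(p₁, η, η′, κ, κ₂, κᵥ) =
(5, 3, 2, 2, 1, 4)`: the three `t = d+3` identities, the LATTICE floor∕credit rows `1 + κ₂ = rr·(q′ − d)`, `d ≤ q′`,
`1 + rr·d + κᵥ = 2p₀` (at the record's `d = 1`), and the gaps `1 ≤ η, η′, κ, κ₂, κᵥ, p₀` [decided toy] -/
theorem identities_C₄ :
    C₄.p₀ + 1 * (O₁.d + 3) + 3 = 2 * 5 ∧ 1 * (C₄.q' + 1) + 1 * (O₁.d + 3) + 2 = 2 * 5 ∧ 1 * (C₄.q' + 1) + 2 = 2 * C₄.p₀ ∧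
      1 + 1 = 1 * (C₄.q' - 1) ∧ 1 ≤ C₄.q' ∧ 1 + 1 * 1 + 4 = 2 * C₄.p₀ ∧
      (1 : ℕ) ≤ 5 ∧ (1 : ℕ) ≤ 3 ∧ (1 : ℕ) ≤ 2 ∧ (1 : ℕ) ≤ 1 ∧ (1 : ℕ) ≤ 4 ∧ 1 ≤ C₄.p₀ := by
  simp [C₄, O₁]


/-! ## §21 The lattice-unit twin record on the toy reading, for any datum, from the displayed inputs -/

section Record

variable {F : T4Family} {G : Type*} [GaugeGroup G] [MeasurableSpace G] [HaarData G] [RegularGaugeGroup G]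

/-- **THE LATTICE-UNIT TWIN RECORD `HistReadDataLWL` INHABITED ON THE TOY READING OF CONSTANT SIZE `Rc`** (part 6's
`histReadDataLW₄` FIELD FOR FIELD with the cost letter PINNED AT THE LATTICE LETTER at a free `M ≥ 0` (`hMΛ`) — `Φf :=
Φ₅ … (lamVolL cΛ M 1 …)`, `hΛL` by `log_lamVolL` — and the exponent rows `hexpFL`∕`hdq`∕`hexpVL` of the lattice road in
place of `hexpF`∕`hexpV`; part 6's words, otherwise unchanged:), run A's and run B's
operations := the toy (1.72)-expansions `toyR (ZD D g₀ os K t)` of the datum's OWN dressed generating functions (H2A∕H2B∕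
«(1.72) holds»∕integrability discharged for every datum), every reading-level field discharged on `ℛ₄ F.L Rc` ∕ `Φ₄` —
`hΛ` by the pin, `hF` at `S_h` and `hsB`∕`hsB′` at the floor by exponentiation, φ-shares `0` under the multiplier `Φ`,
`m := A₁²`, (2.9) on constant sizes —, PARAMETRIC in `(C, O)` under their sign letters and in the census letters under the
five identities + gaps, from EXACTLY: measurable averagings `hM`, the K-uniform envelope `hZ`, (2.5) `isRj` at the size
`Rc`, the pinned cost `1 ≤ lamVol` and (2.7) `h27` (at `β′ = 0`, power `1`, any `β₀ ≥ 0`) on the datum's couplings, the (γ)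
floors and site budgets, and the S-rows as PARAMETERS (`β′ := 0`; (2.9) on constant sizes for any `β₀`). [folklore] -/
def histReadDataLWL₄ (D : FiniteEpsData F G) (hM : D.AvgMeasurable) {C : T4PrintedShapeBanking.Consts} {O : PrintedO1s}
    (hn₁ : 13 ≤ C.n₁) (hE₂ : 0 < C.E₂) (hE₃ : 0 < C.E₃) (hp₀ : 1 ≤ C.p₀) (hA₀ : 0 < C.A₀) (hγ₀ : 0 < O.γ₀)
    (hA₁ : O.A₁ ≠ 0) (hMO : 0 < O.M) (hβd : O.β₀ * ((O.d : ℝ) + 2) ≤ 1) {θv : ℝ} (hθv : 0 < θv) (rr n : ℕ)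
    (hn : 0 < n) (g₀ : ℕ → ℝ) (os : List (ULoop F)) {Rc : ℕ} (hRc : 2 ≤ Rc) {cΛ M Lr Φ β₀ : ℝ} (hcΛ : 0 ≤ cΛ)
    (hMΛ : 0 ≤ M) (hLr : 0 ≤ Lr) (hΦ : 0 ≤ Φ) (hβ₀ : 0 ≤ β₀) {p₁ η η' κ κ₂ κᵥ : ℕ} (hexpR : C.p₀ + rr * (O.d + 3) + η = 2 * p₁)
    (hexpR' : rr * (C.q' + 1) + rr * (O.d + 3) + η' = 2 * p₁) (hexpB : rr * (C.q' + 1) + κ = 2 * C.p₀)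
    (hexpFL : 1 + κ₂ = rr * (C.q' - 1)) (hdq : 1 ≤ C.q') (hexpVL : 1 + rr * 1 + κᵥ = 2 * C.p₀) (hη : 1 ≤ η)
    (hη' : 1 ≤ η') (hκ : 1 ≤ κ) (hκ₂ : 1 ≤ κ₂) (hκᵥ : 1 ≤ κᵥ) {Zi : ℝ} (hZ : ∀ K t, |t| ≤ 1 → ZD D g₀ os K t ≤ Zi)
    (isRj : ∀ K s, s ≤ K → B14.IsRj F.L rr ((D.C ⟨K, F.m, g₀ K⟩).flow.g s) Rc)
    (hΛ1 : ∀ K t, 1 ≤ lamVolL cΛ M 1 (D.C ⟨K, F.m, g₀ K⟩).flow.g ((ℛ₄ F.L Rc).R K) K t)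
    (h27 : ∀ K, B14.FlowIneq27 (D.C ⟨K, F.m, g₀ K⟩).flow.g 0 β₀ 1 K)
    {c₀ n₁ : ℝ} (c₀_pos : 0 < c₀) (floor : ∀ K, c₀ ≤ smallFieldMass D K (g₀ K))
    (floor' : ∀ K, c₀ ≤ smallFieldMass D (K + 1) (g₀ (K + 1)))
    (sites : ∀ K, ((D.C ⟨K, F.m, g₀ K⟩).numSites K : ℝ) ≤ n₁)
    (sites' : ∀ K, ((D.C ⟨K + 1, F.m, g₀ (K + 1)⟩).numSites (K + 1) : ℝ) ≤ n₁)
    {shA shB : ℕ → ℝ → HIndex.Idx Isk → ℝ} {Wsh : ℕ → ℝ}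
    (shell : ShellWeightBound 1 (HIndex.termSet Isk)
      (fun _ t => Repr172R.weight μ₀ (fun K t => toyR (ZD D g₀ os K t)) t)
      (weightB μ₀ (fun K t => toyR (ZD D g₀ os K t)) trunc₃) shA shB Wsh)
    {Cc Rr CcRec RrRec : ℕ → ℝ → HIndex.Idx Isk → ℝ} {ν u s₂ q₀ r s : ℕ → ℝ}
    (budget : ReindexedBudget 1 1 (HIndex.termSet Isk)
      (fun K t τ => Repr172R.weight μ₀ (fun K t => toyR (ZD D g₀ os K t)) t τ - shA K t τ)
      (fun K t τ => weightB μ₀ (fun K t => toyR (ZD D g₀ os K t)) trunc₃ K t τ - shB K t τ)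
      (badOfClass (bstrOf Prod.fst (memA n F.L (ℛ₄ F.L Rc))) (HIndex.termSet Isk)
        (fun K _ => badClasses Prod.fst (memA n F.L (ℛ₄ F.L Rc)) jhalf (HIndex.termSet Isk) K))
      Cc Rr CcRec RrRec ν u s₂ q₀ r s)
    (sum_r : Summable r) (sum_u : Summable u) (sum_s : Summable s) (sum_s₂ : Summable s₂) :
    HistReadDataLWL D C O θv rr 1 n hn g₀ os cΛ M Lr Φ β₀ p₁ η η' κ κ₂ κᵥ Isk Isk (fun _ => Unit) μ₀
      (fun _ => GoodClass.top Unit) (fun _ => Unit) μ₀ (fun _ => GoodClass.top Unit) where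
  l₀ := 1
  vol := 1
  l₀_pos := one_pos
  vol_pos := one_pos
  K₀ := 0
  RA K t := toyR (ZD D g₀ os K t)
  ρA K t V := ∑ a : (Isk K).Adm, (toyR (ZD D g₀ os K t)).term a V
  holdsA _ _ _ := rfl
  intA _ _ _ _ _ := Integrable.of_finite
  H2A K t _ _ := by
    show ZD D g₀ os K t = ∫ x, ∑ a : (Isk K).Adm, (toyR (ZD D g₀ os K t)).term a x ∂(Measure.dirac ())
    rw [MeasureTheory.integral_dirac, sum_term_toyR (ZD_pos D hM g₀ os K t)]
  ℛ := ℛ₄ F.L Rc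
  hL := rfl
  hs := rfl
  Φf := Φ₅ O (O.A₁ ^ 2) C Lr p₁ Rc (fun K => (D.C ⟨K, F.m, g₀ K⟩).flow.g) (ZD D g₀ os)
    (fun K t => lamVolL cΛ M 1 (D.C ⟨K, F.m, g₀ K⟩).flow.g ((ℛ₄ F.L Rc).R K) K t) hΛ1
  hR := histRead_toy₅ O (O.A₁ ^ 2) C Lr p₁ Rc _ (ZD D g₀ os) _ hΛ1 F.L
  isRj := isRj
  one_le_R _ _ _ := le_trans one_le_two hRc
  hL4 := HistoryRealiseCellsRunPinned.four_le_L F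
  hprof K _ t _ := runProfile_succ_le_toy₄ F.L Rc K t
  hdrop K _ m := dropCtl_runProfile_toy₄ F.L Rc K m
  hN K _ τ _ := newOK_run₄ F.L Rc K τ
  hRm K _ τ _ := rm_le_run₄ F.L hRc K τ
  hRmS K _ τ _ := rmS_run₄ F.L hRc K τ
  hRm2 K _ τ _ := rm2_run₄ F.L Rc K τ
  hD K _ τ _ := newDisjoint_run₄ F.L Rc K τ
  hreg K _ τ _ := regionsInBox_run₄ F.L Rc n K τ
  hn₁ := hn₁
  hE₂ := hE₂
  hE₃pos := hE₃
  sB K := sBsharp O (O.A₁ ^ 2) C (D.C ⟨K, F.m, g₀ K⟩).flow.g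
  φB _ _ _ := 0
  φR _ _ := 0
  β' := 0
  hF K _ := factorRead_toy₅ O (O.A₁ ^ 2) C Lr p₁ Rc _ (ZD D g₀ os) _ hΛ1 F.L K
  h29 K _ := flow29_const₄ (le_trans (by norm_num) (two_le_L F)) _ β₀ K
  W _ := 2
  one_le_W _ := one_le_two
  Wi := 2
  BAi := Real.log (Zi / 6)
  mi := 1
  hWi _ := le_rfl
  hBA K _ ht _ := BA_le_of_le₅ O (O.A₁ ^ 2) C Lr p₁ Rc _ _ hΛ1 (fun K t _ => ZD_pos D hM g₀ os K t) hZ K ht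
  hmi K := le_of_eq (by simp [μ₀])
  hρ K _ _ _ k hk := absurd hk (not_mem_badGMems₄ F.L Rc _ _ jhalf K k)
  c₀ := c₀
  n₁ := n₁
  c₀_pos := c₀_pos
  floor K _ := floor K
  floor' K _ := floor' K
  sites K _ := sites K
  sites' K _ := sites' K
  RB K t := toyR (ZD D g₀ os K t)
  ρB K t V := ∑ a : (Isk (K + 1)).Adm, (toyR (ZD D g₀ os (K + 1) t)).term a V
  holdsB _ _ _ := rfl
  intB _ _ _ _ _ := Integrable.of_finite
  H2B K t _ _ := by
    show ZD D g₀ os (K + 1) t =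
      ∫ x, ∑ a : (Isk (K + 1)).Adm, (toyR (ZD D g₀ os (K + 1) t)).term a x ∂(Measure.dirac ())
    rw [MeasureTheory.integral_dirac, sum_term_toyR (ZD_pos D hM g₀ os (K + 1) t)]
  trunc := trunc₃
  htr K _ := trunc₃_mem K
  dB _ _ _ := 0
  mup _ _ := 0
  sB' K := sBsharp O (O.A₁ ^ 2) C (D.C ⟨K, F.m, g₀ K⟩).flow.g
  φB' _ _ _ := 0
  φR' _ _ := 0
  upB K _ _ _ k hk := absurd hk (not_mem_badGMems₄ F.L Rc _ _ jhalf K k)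
  deadB_nonneg K _ _ _ k hk := absurd hk (not_mem_badGMems₄ F.L Rc _ _ jhalf K k)
  resumB K _ _ _ k hk := absurd hk (not_mem_badGMems₄ F.L Rc _ _ jhalf K k)
  mup_bd _ _ _ _ := ⟨le_rfl, by positivity⟩
  shA := shA
  shB := shB
  Wsh := Wsh
  shell := shell
  Cc := Cc
  Rr := Rr
  CcRec := CcRec
  RrRec := RrRec
  ν := ν
  u := u
  s₂ := s₂
  q₀ := q₀
  r := r
  s := s
  budget := budget
  sum_r := sum_r
  sum_u := sum_u
  sum_s := sum_s
  sum_s₂ := sum_s₂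
  hcΛ := hcΛ
  hMΛ := hMΛ
  hΛL K t := log_lamVolL cΛ M 1 _ _ K t
  hθv := hθv
  hβ₀ := hβ₀
  hLr := hLr
  hΦ := hΦ
  m := O.A₁ ^ 2
  hm := le_rfl
  hexpR := hexpR
  hexpR' := hexpR'
  hexpB := hexpB
  hexpFL := hexpFL
  hdq := hdq
  hexpVL := hexpVL
  hη := hη
  hη' := hη'
  hκ := hκ
  hκ₂ := hκ₂
  hκᵥ := hκᵥ
  hp₀ := hp₀
  hAp := ApFlat_ne_zero hγ₀ hA₁ hMO hLr O.d
  hγ₀ := hγ₀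
  hA₁ := hA₁
  hA₀ := hA₀
  hM := hMO
  hβd := hβd
  hφB K _ _ := mul_nonneg hΦ (dshare_nonneg hE₂.le hE₃.le _)
  hφR K _ := mul_nonneg hΦ (dshare_nonneg hE₂.le hE₃.le _)
  hφB' K _ _ := mul_nonneg hΦ (dshare_nonneg hE₂.le hE₃.le _)
  hφR' K _ := mul_nonneg hΦ (dshare_nonneg hE₂.le hE₃.le _)
  hsB _ _ _ := le_rfl
  hsB' _ _ _ := le_rfl
  p27 := 1
  hp27 := le_rfl
  h27 K _ := h27 K

end Record

end

end Summit.QuantumFields.BalabanUV.T4Continuum.HistoryRealiseCellsRunAssemblyWTVSSanity
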